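import Summits.FinalStateConjecture.FinalStateConjecture.Theorems.PhotonSphereChannelsExteriorEnergyRW

/-!
# Route PhotonSphereChannels — time shifts of solutions; stub L reduces to outgoing-energy exhaustion

Helper file for stub `stub_futureSilentWavesVanish` (L) of line `isolated-kerr-connected-hull` (crux
stmt-FinalStateConjecture-14075), over the Literature vocabulary
`ReggeWheeler.{energyDensity, IsSolution, exteriorEnergy, channelEnergy, totalEnergy, IsRWSolution}`:

* `RW.IsSolution.shift` — time shifts `ψ(T + ·)` of global `C²` solutions are global solutions;
  `RW.energyDensity_shift`, `RW.totalEnergy_shift`, `RW.exteriorEnergy_shift` — bookkeeping;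
* `RW.channelEnergy_shift_mono` — the forward channel energy of `ψ(T + ·)` through the bare light cone
  about `xc` (the silence functional of stub L) is non-decreasing in the centre `T` (later cones are
  narrower), hence has a limit as `T → +∞`, bounded by the (conserved) total energy
  (`RW.channelEnergy_shift_le_totalEnergy`);
* `RW.eq_zero_of_silent_of_exhaustion` — **the reduction (H1 + H4 ⇒ L)**: if that limit IS the total
  energy ("outgoing-energy exhaustion" = asymptotic completeness in energy form, H4) and the solution
  is silent at every centre, then it vanishes identically; `RW.futureSilentWavesVanish_of_exhaustion`
  is the statement of stub L with H4 (for the same `M, r, xc, s, ℓ, ψ`) as an explicit extra hypothesis.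

(The two inputs from `…RTotalEnergyConservation` — conservation of the total energy and the zero-energy
rigidity H1 — are re-derived here as `private` lemmas so that this file does not depend on that module's
build; the public statements live there.)

H4 itself — `Tendsto (fun T ↦ channelEnergy V xc 0 (ψ(T + ·)) atTop) atTop (𝓝 (totalEnergy V ψ 0))`
for finite-energy Regge–Wheeler solutions — is NOT proved here (it is the 1+1 short-range scattering
theorem: Morawetz/integrated local energy decay at the potential's maximum plus `r^p`-weighted
propagation at both ends, or spectral scattering theory).  No new definitions. [folklore]
-/

namespace Summit.FinalStateConjecture.FinalStateConjecture.Theorems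

-- every `Summit.FinalStateConjecture.FinalStateConjecture.…` name repeats the summit = sub-problem
-- segment (D-0017 layout), as in every landed `…Theorems` file of this route
set_option linter.dupNamespace false

open MeasureTheory Set Filter Topology
open Literature.Geometry.Lorentzian Literature.Geometry.Lorentzian.ReggeWheeler

noncomputable section

namespace RW

section General

variable {V : ℝ → ℝ} {ψ : ℝ → ℝ → ℝ}


/-! ### Private copies of energy conservation and H1 (public versions: `…RTotalEnergyConservation`) -/

/-- Dictionary (`he` format of the `WaveEnergy` files). -/
private theorem energyDensity_he₀ (hψ : ContDiff ℝ 2 (Function.uncurry ψ)) :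
    ∀ z : ℝ × ℝ, (fun z : ℝ × ℝ ↦ energyDensity V ψ z.1 z.2) z
      = (fderiv ℝ (Function.uncurry ψ) z (1, 0)) ^ 2 + (fderiv ℝ (Function.uncurry ψ) z (0, 1)) ^ 2
        + V z.2 * Function.uncurry ψ z ^ 2 := by
  rintro ⟨t, x⟩
  simp only [Function.uncurry_apply_pair]
  unfold energyDensity
  rw [WaveEnergy.deriv_slice_fst_eq hψ, WaveEnergy.deriv_slice_snd_eq hψ]

/-- Dictionary (`hsol` format of the `WaveEnergy` files). -/
private theorem fderiv_eq₀ (hψ : IsSolution V ψ) :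
    ∀ z : ℝ × ℝ, fderiv ℝ (fderiv ℝ (Function.uncurry ψ)) z (1, 0) (1, 0)
      - fderiv ℝ (fderiv ℝ (Function.uncurry ψ)) z (0, 1) (0, 1) + V z.2 * Function.uncurry ψ z = 0 := by
  rintro ⟨t, x⟩
  rw [← WaveEnergy.iteratedDeriv_two_slice_fst_eq hψ.1, ← WaveEnergy.iteratedDeriv_two_slice_snd_eq hψ.1]
  exact hψ.2 (t, x)

/-- Half-line energies are bounded by the total energy at any other time. -/
private theorem setLIntegral_Ioi_le_totalEnergy₀ (hV : Differentiable ℝ V) (hV0 : ∀ x, 0 ≤ V x)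
    (hψ : IsSolution V ψ) (c t₁ t₂ : ℝ) :
    ∫⁻ x in Ioi c, ENNReal.ofReal (energyDensity V ψ t₁ x) ≤ totalEnergy V ψ t₂ := by
  have he := energyDensity_he₀ (V := V) hψ.1
  have hsol := fderiv_eq₀ hψ
  rcases le_total t₁ t₂ with h | h
  · exact (WaveEnergy.lintegral_Ioi_le_expanding hψ.1 hV hV0 hsol he c h).trans
      (setLIntegral_le_lintegral _ _)
  · have key := WaveEnergy.lintegral_Ioi_shrinking_le hψ.1 hV hV0 hsol he (c - (t₁ - t₂)) h
    have e1 : c - (t₁ - t₂) + (t₁ - t₂) = c := by ring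
    rw [e1] at key
    exact key.trans (setLIntegral_le_lintegral _ _)

/-- Conservation of the total energy (private copy of `RW.totalEnergy_eq_totalEnergy`). -/
private theorem totalEnergy_eq_totalEnergy₀ (hV : Differentiable ℝ V) (hV0 : ∀ x, 0 ≤ V x)
    (hψ : IsSolution V ψ) (t₁ t₂ : ℝ) : totalEnergy V ψ t₁ = totalEnergy V ψ t₂ := by
  have hdir : Directed (· ⊆ ·) (fun n : ℕ ↦ Ioi (-(n : ℝ))) := by
    refine Monotone.directed_le fun i j hij ↦ Ioi_subset_Ioi ?_
    exact neg_le_neg (Nat.cast_le.mpr hij)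
  have hU : (⋃ n : ℕ, Ioi (-(n : ℝ))) = univ := by
    refine eq_univ_of_forall fun x ↦ ?_
    obtain ⟨n, hn⟩ := exists_nat_gt (-x)
    exact mem_iUnion.2 ⟨n, by simp only [mem_Ioi]; linarith⟩
  have hsup : ∀ t, totalEnergy V ψ t
      = ⨆ n : ℕ, ∫⁻ x in Ioi (-(n : ℝ)), ENNReal.ofReal (energyDensity V ψ t x) := fun t ↦ by
    unfold totalEnergy
    rw [← setLIntegral_univ, ← hU, setLIntegral_iUnion_of_directed _ hdir]
  apply le_antisymm
  · rw [hsup t₁]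
    exact iSup_le fun n ↦ setLIntegral_Ioi_le_totalEnergy₀ hV hV0 hψ _ t₁ t₂
  · rw [hsup t₂]
    exact iSup_le fun n ↦ setLIntegral_Ioi_le_totalEnergy₀ hV hV0 hψ _ t₂ t₁

/-- Zero-energy rigidity H1 (private copy of `RW.eq_zero_of_totalEnergy_eq_zero`). -/
private theorem eq_zero_of_totalEnergy_eq_zero₀ (hV : Differentiable ℝ V) (hVpos : ∀ x, 0 < V x)
    (hψ : IsSolution V ψ) {t₀ : ℝ} (h0 : totalEnergy V ψ t₀ = 0) (t x : ℝ) : ψ t x = 0 := by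
  have hV0 : ∀ x, 0 ≤ V x := fun x ↦ (hVpos x).le
  have ht : totalEnergy V ψ t = 0 := by rw [totalEnergy_eq_totalEnergy₀ hV hV0 hψ t t₀, h0]
  have hc : Continuous fun y ↦ ENNReal.ofReal (energyDensity V ψ t y) :=
    ENNReal.continuous_ofReal.comp
      ((WaveEnergy.continuous_energyDensity hψ.1 hV (energyDensity_he₀ hψ.1)).comp
        (Continuous.prodMk_right t))
  unfold totalEnergy at ht
  rw [lintegral_eq_zero_iff hc.measurable] at ht
  have hx : ENNReal.ofReal (energyDensity V ψ t x) = 0 :=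
    congr_fun ((Continuous.ae_eq_iff_eq volume hc continuous_const).1 ht) x
  rw [ENNReal.ofReal_eq_zero] at hx
  have he : energyDensity V ψ t x = 0 := le_antisymm hx (energyDensity_nonneg ψ t (hV0 x))
  unfold energyDensity at he
  have h3 : V x * ψ t x ^ 2 = 0 := by
    nlinarith [sq_nonneg (deriv (fun τ ↦ ψ τ x) t), sq_nonneg (deriv (ψ t) x),
      mul_nonneg (hV0 x) (sq_nonneg (ψ t x))]
  rcases mul_eq_zero.1 h3 with h | h
  · exact absurd h (hVpos x).ne'
  · exact pow_eq_zero_iff (n := 2) (by norm_num) |>.1 h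

/-- **Time shifts of global solutions are global solutions.** [folklore] -/
theorem IsSolution.shift (hψ : IsSolution V ψ) (T : ℝ) : IsSolution V (fun s y ↦ ψ (T + s) y) := by
  refine ⟨?_, fun z ↦ ?_⟩
  · have h : Function.uncurry (fun s y ↦ ψ (T + s) y)
        = Function.uncurry ψ ∘ fun p : ℝ × ℝ ↦ (T + p.1, p.2) := by
      funext p
      rfl
    rw [h]
    exact hψ.1.comp ((contDiff_const.add contDiff_fst).prodMk contDiff_snd)
  · show iteratedDeriv 2 (fun τ ↦ ψ (T + τ) z.2) z.1 - iteratedDeriv 2 (fun y ↦ ψ (T + z.1) y) z.2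
      + V z.2 * ψ (T + z.1) z.2 = 0
    rw [iteratedDeriv_comp_const_add 2 (fun τ ↦ ψ τ z.2) T]
    exact hψ.2 (T + z.1, z.2)

/-- Energy density of the time-shifted function: `e[ψ(T + ·)](t, x) = e[ψ](T + t, x)`. [folklore] -/
theorem energyDensity_shift (V : ℝ → ℝ) (ψ : ℝ → ℝ → ℝ) (T t x : ℝ) :
    energyDensity V (fun s y ↦ ψ (T + s) y) t x = energyDensity V ψ (T + t) x := by
  unfold energyDensity
  rw [deriv_comp_const_add (fun σ ↦ ψ σ x) T t]

/-- Total energy of the time-shifted function: `E[ψ(T + ·)](t) = E[ψ](T + t)`. [folklore] -/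
theorem totalEnergy_shift (V : ℝ → ℝ) (ψ : ℝ → ℝ → ℝ) (T t : ℝ) :
    totalEnergy V (fun s y ↦ ψ (T + s) y) t = totalEnergy V ψ (T + t) := by
  unfold totalEnergy
  exact lintegral_congr fun x ↦ by rw [energyDensity_shift]

/-- Iterated time shifts. [folklore] -/
theorem shift_shift (ψ : ℝ → ℝ → ℝ) (T₁ T₂ : ℝ) :
    (fun s y ↦ (fun s' y' ↦ ψ (T₁ + s') y') (T₂ + s) y) = fun s y ↦ ψ (T₁ + T₂ + s) y := by
  funext s y
  simp only [add_assoc]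

/-- Forward exterior energies of two time shifts: the bare cone of the LATER centre `T + Δ` (`Δ ≥ 0`)
at its time `t ≥ 0` contains the bare cone of the earlier centre `T` at its time `t + Δ` (same
absolute time `T + Δ + t`), so its exterior energy is larger. [folklore] -/
theorem exteriorEnergy_shift_mono (V : ℝ → ℝ) (ψ : ℝ → ℝ → ℝ) (xc T : ℝ) {Δ t : ℝ} (hΔ : 0 ≤ Δ)
    (ht : 0 ≤ t) :
    exteriorEnergy V xc 0 (fun s y ↦ ψ (T + s) y) (t + Δ)
      ≤ exteriorEnergy V xc 0 (fun s y ↦ ψ (T + Δ + s) y) t := by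
  unfold exteriorEnergy
  have hsub : {x : ℝ | 0 + |t + Δ| < |x - xc|} ⊆ {x : ℝ | 0 + |t| < |x - xc|} := by
    intro x hx
    simp only [mem_setOf_eq] at hx ⊢
    rw [abs_of_nonneg (by linarith : 0 ≤ t + Δ)] at hx
    rw [abs_of_nonneg ht]
    linarith
  calc ∫⁻ x in {x : ℝ | 0 + |t + Δ| < |x - xc|},
        ENNReal.ofReal (energyDensity V (fun s y ↦ ψ (T + s) y) (t + Δ) x)
      = ∫⁻ x in {x : ℝ | 0 + |t + Δ| < |x - xc|},
        ENNReal.ofReal (energyDensity V (fun s y ↦ ψ (T + Δ + s) y) t x) := by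
        refine lintegral_congr fun x ↦ ?_
        rw [energyDensity_shift, energyDensity_shift, show T + (t + Δ) = T + Δ + t by ring]
    _ ≤ _ := lintegral_mono_set hsub

/-- **The silence functional is non-decreasing in the centre**: for `T₁ ≤ T₂` the forward channel
energy of `ψ(T₁ + ·)` through the bare light cone about `xc` is at most that of `ψ(T₂ + ·)`.
[folklore] -/
theorem channelEnergy_shift_mono (V : ℝ → ℝ) (ψ : ℝ → ℝ → ℝ) (xc : ℝ) {T₁ T₂ : ℝ} (hT : T₁ ≤ T₂) :
    channelEnergy V xc 0 (fun s y ↦ ψ (T₁ + s) y) atTop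
      ≤ channelEnergy V xc 0 (fun s y ↦ ψ (T₂ + s) y) atTop := by
  unfold channelEnergy
  set Δ := T₂ - T₁ with hΔ
  have hΔ0 : 0 ≤ Δ := sub_nonneg.2 hT
  have hT2 : T₂ = T₁ + Δ := by rw [hΔ]; ring
  -- `liminf_{t→∞} E₁(t) = liminf_{t→∞} E₁(t + Δ) ≤ liminf_{t→∞} E₂(t)`
  have h1 : liminf (exteriorEnergy V xc 0 (fun s y ↦ ψ (T₁ + s) y)) atTop
      = liminf ((exteriorEnergy V xc 0 (fun s y ↦ ψ (T₁ + s) y)) ∘ fun t ↦ t + Δ) atTop := by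
    rw [liminf_comp, map_add_atTop_eq]
  rw [h1]
  refine liminf_le_liminf ?_
  filter_upwards [eventually_ge_atTop (0 : ℝ)] with t ht
  rw [Function.comp_apply, hT2]
  exact exteriorEnergy_shift_mono V ψ xc T₁ hΔ0 ht

/-- The silence functional is bounded by the total energy (`V ≥ 0` differentiable, global `C²`
solution). [folklore] -/
theorem channelEnergy_shift_le_totalEnergy (hV : Differentiable ℝ V) (hV0 : ∀ x, 0 ≤ V x)
    (hψ : IsSolution V ψ) (xc T : ℝ) :
    channelEnergy V xc 0 (fun s y ↦ ψ (T + s) y) atTop ≤ totalEnergy V ψ 0 := by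
  unfold channelEnergy
  refine liminf_le_of_frequently_le (Frequently.of_forall fun t ↦ ?_)
  calc exteriorEnergy V xc 0 (fun s y ↦ ψ (T + s) y) t
      ≤ totalEnergy V (fun s y ↦ ψ (T + s) y) t := exteriorEnergy_le_totalEnergy V xc 0 _ t
    _ = totalEnergy V ψ (T + t) := totalEnergy_shift V ψ T t
    _ = totalEnergy V ψ 0 := totalEnergy_eq_totalEnergy₀ hV hV0 hψ (T + t) 0

/-- Hence the silence functional has a limit as the centre tends to `+∞` (its supremum). [folklore] -/
theorem tendsto_channelEnergy_shift (V : ℝ → ℝ) (ψ : ℝ → ℝ → ℝ) (xc : ℝ) :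
    Tendsto (fun T ↦ channelEnergy V xc 0 (fun s y ↦ ψ (T + s) y) atTop) atTop
      (𝓝 (⨆ T, channelEnergy V xc 0 (fun s y ↦ ψ (T + s) y) atTop)) :=
  tendsto_atTop_iSup fun _ _ h ↦ channelEnergy_shift_mono V ψ xc h

/-- **The reduction of stub L to outgoing-energy exhaustion (H1 + H4 ⇒ L).** Let `V > 0` be
differentiable and `ψ` a global `C²` solution.  If the forward channel energy of `ψ(T + ·)` through
the bare light cone about `xc` tends to the total energy as `T → +∞` (H4: eventually all the energy
is radiated through `𝓘⁺ ∪ 𝓗⁺`), and `ψ` is silent at every centre, then `ψ ≡ 0`. [folklore] -/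
theorem eq_zero_of_silent_of_exhaustion (hV : Differentiable ℝ V) (hVpos : ∀ x, 0 < V x)
    (hψ : IsSolution V ψ) {xc : ℝ}
    (hexh : Tendsto (fun T ↦ channelEnergy V xc 0 (fun t x ↦ ψ (T + t) x) atTop) atTop
      (𝓝 (totalEnergy V ψ 0)))
    (hsil : ∀ T : ℝ, channelEnergy V xc 0 (fun t x ↦ ψ (T + t) x) atTop = 0) (t x : ℝ) :
    ψ t x = 0 := by
  have hfun : (fun T ↦ channelEnergy V xc 0 (fun t x ↦ ψ (T + t) x) atTop) = fun _ ↦ 0 :=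
    funext hsil
  rw [hfun] at hexh
  have hE : totalEnergy V ψ 0 = 0 := (tendsto_nhds_unique tendsto_const_nhds hexh).symm
  exact eq_zero_of_totalEnergy_eq_zero₀ hV hVpos hψ hE t x

end General

/-! ### Regge–Wheeler instance: stub L given H4 -/

section ReggeWheelerInstance

/-- **Stub `stub_futureSilentWavesVanish` with H4 as an explicit hypothesis.** The registered
statement of stub L, for a fixed `M, r, xc, s, ℓ, ψ`, follows from the outgoing-energy exhaustion of
that `ψ` (H4, the hypothesis `hexh`); `0 < M` and `s ≤ 2` are not used. [folklore] -/
theorem futureSilentWavesVanish_of_exhaustion {M : ℝ} {r : ℝ → ℝ} {xc : ℝ}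
    (hr : IsTortoiseRadius M r xc) {s ℓ : ℕ} (hsℓ : s ≤ ℓ) {ψ : ℝ → ℝ → ℝ}
    (hψ : IsRWSolution M s ℓ r ψ)
    (hexh : Tendsto (fun T ↦ channelEnergy (linePotential M s ℓ r) xc 0 (fun t x ↦ ψ (T + t) x) atTop)
      atTop (𝓝 (totalEnergy (linePotential M s ℓ r) ψ 0)))
    (hsil : ∀ T : ℝ, channelEnergy (linePotential M s ℓ r) xc 0 (fun t x ↦ ψ (T + t) x) atTop = 0)
    (t x : ℝ) : ψ t x = 0 :=
  eq_zero_of_silent_of_exhaustion (differentiable_linePotential hr s ℓ) (linePotential_pos hr hsℓ) hψ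
    hexh hsil t x

/-- **Registered sub-goal `stub_futureSilentWavesVanish_of_H4` of stub L** (crux
stmt-FinalStateConjecture-14075, line `isolated-kerr-connected-hull`): stub L for a fixed
`M, r, xc, s, ℓ, ψ` follows from outgoing-energy exhaustion (H4) of that `ψ`. [folklore] -/
theorem stub_futureSilentWavesVanish_of_H4 :
    ∀ (M : ℝ) (r : ℝ → ℝ) (xc : ℝ), ReggeWheeler.IsTortoiseRadius M r xc →
      ∀ (s ℓ : ℕ), s ≤ ℓ → ∀ ψ : ℝ → ℝ → ℝ, ReggeWheeler.IsRWSolution M s ℓ r ψ →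
        Filter.Tendsto (fun T ↦ ReggeWheeler.channelEnergy (ReggeWheeler.linePotential M s ℓ r) xc 0
          (fun t x ↦ ψ (T + t) x) Filter.atTop) Filter.atTop
          (nhds (ReggeWheeler.totalEnergy (ReggeWheeler.linePotential M s ℓ r) ψ 0)) →
        (∀ T : ℝ, ReggeWheeler.channelEnergy (ReggeWheeler.linePotential M s ℓ r) xc 0
          (fun t x ↦ ψ (T + t) x) Filter.atTop = 0) →
        ∀ t x, ψ t x = 0 :=
  fun _ _ _ hr _ _ hsℓ _ hψ hexh hsil ↦ futureSilentWavesVanish_of_exhaustion hr hsℓ hψ hexh hsil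

end ReggeWheelerInstance

end RW

end

end Summit.FinalStateConjecture.FinalStateConjecture.Theorems
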